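import Mathlib

/-!
# A character of finite order on a finite-index subgroup extends only to characters of finite order

Kernel support (seat p3, cell pub-hodge-repro2) behind §F.2 of `route/T5-route-3.md` (the auxiliary
modulus): «the resulting character of the open subgroup `E¹H_𝔪/E¹` then extends to a (continuous,
finite-order) character of `E¹(𝔸)/E¹` by Pontryagin duality». The existence of the extension is
Pontryagin duality (prose; p4's profinite files for the open-subgroup case); this file is the
parenthetical «finite-order»: an open subgroup of a compact group has finite index, and ANY
extension `φ` of a character of finite order `n` from a subgroup `H` of finite index `m` of a
commutative group has order dividing `m·n` — because `φⁿ` is trivial on `H`, hence factors through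
the finite group `G/H`, on which every element has order dividing `m` (Lagrange: `g^m ∈ H`).

* `pow_eq_one_of_finiteIndex`: `(∀ h ∈ H, φ h ^ n = 1) → φ g ^ (H.index * n) = 1`;
* `exists_pow_eq_one_of_finiteIndex`: a positive exponent killing `φ` exists;
* `map_mem_rootsOfUnity_of_finiteIndex`: for `φ : G →* Kˣ` the values lie in the roots of unity;
* `orderOf_dvd_of_finiteIndex`: the order of `φ` in `G →* M` divides `H.index * n`;
* `finiteIndex_of_isOpen` / `pow_eq_one_of_isOpen`: an open subgroup of a compact group has finite
  index (Mathlib's `Subgroup.quotient_finite_of_isOpen`), so the statement applies to the open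
  subgroup `E¹H_𝔪/E¹` of the compact group `E¹(𝔸)/E¹` of §F.2.

Header declaration (README §8(d)): uses an L-value-free non-vanishing device: no.
-/

namespace Summit.Ventures.HodgeRepro2.T5FiniteOrderExtension

variable {G M : Type*} [CommGroup G] [CommGroup M]

/-- If `φ : G →* M` has `φ h ^ n = 1` on a subgroup `H` of finite index, then
`φ g ^ (H.index · n) = 1` for every `g`: `g ^ H.index ∈ H` (Lagrange in the finite group `G/H`). -/
theorem pow_eq_one_of_finiteIndex (H : Subgroup G) [H.FiniteIndex] (φ : G →* M) (n : ℕ)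
    (hn : ∀ h ∈ H, φ h ^ n = 1) (g : G) : φ g ^ (H.index * n) = 1 := by
  rw [pow_mul, ← map_pow]
  exact hn _ (H.pow_index_mem g)

/-- The same with a positive exponent made explicit: some `m > 0` has `φ g ^ m = 1` for all `g`. -/
theorem exists_pow_eq_one_of_finiteIndex (H : Subgroup G) [H.FiniteIndex] (φ : G →* M) (n : ℕ)
    (hn0 : 0 < n) (hn : ∀ h ∈ H, φ h ^ n = 1) : ∃ m : ℕ, 0 < m ∧ ∀ g : G, φ g ^ m = 1 :=
  ⟨H.index * n, Nat.mul_pos (Nat.pos_of_ne_zero Subgroup.FiniteIndex.index_ne_zero) hn0,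
    pow_eq_one_of_finiteIndex H φ n hn⟩

/-- The order of `φ` in the group `G →* M` divides `H.index · n`. -/
theorem orderOf_dvd_of_finiteIndex (H : Subgroup G) [H.FiniteIndex] (φ : G →* M) (n : ℕ)
    (hn : ∀ h ∈ H, φ h ^ n = 1) : orderOf φ ∣ H.index * n := by
  apply orderOf_dvd_of_pow_eq_one
  ext g
  rw [MonoidHom.pow_apply, MonoidHom.one_apply]
  exact pow_eq_one_of_finiteIndex H φ n hn g

/-- An extension to `G` of a character of finite order of a finite-index subgroup `H` has
finite order: the restriction is the datum, the conclusion is about the extension. -/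
theorem orderOf_pos_of_finiteIndex (H : Subgroup G) [H.FiniteIndex] (φ : G →* M) (n : ℕ)
    (hn0 : 0 < n) (hn : ∀ h ∈ H, φ h ^ n = 1) : 0 < orderOf φ := by
  obtain ⟨m, hm0, hm⟩ := exists_pow_eq_one_of_finiteIndex H φ n hn0 hn
  have hφm : φ ^ m = 1 := by
    ext g
    rw [MonoidHom.pow_apply, MonoidHom.one_apply]
    exact hm g
  exact (isOfFinOrder_iff_pow_eq_one.2 ⟨m, hm0, hφm⟩).orderOf_pos

/-- For a character with values in the units of a field (`ℂˣ` in §F.2), the values of any extension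
of a finite-order character from a finite-index subgroup are roots of unity. -/
theorem map_mem_rootsOfUnity_of_finiteIndex {K : Type*} [Field K] (H : Subgroup G) [H.FiniteIndex]
    (φ : G →* Kˣ) (n : ℕ) (hn : ∀ h ∈ H, φ h ^ n = 1) (g : G) :
    φ g ∈ rootsOfUnity (H.index * n) K := by
  rw [mem_rootsOfUnity]
  exact pow_eq_one_of_finiteIndex H φ n hn g

/-- The restriction of a character of finite order `n` to any subgroup has order dividing `n`
(the trivial direction, recorded for the round trip). -/
theorem restrict_pow_eq_one (H : Subgroup G) (φ : G →* M) (n : ℕ) (hφ : ∀ g : G, φ g ^ n = 1)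
    (h : H) : (φ.restrict H) h ^ n = 1 :=
  hφ h

section Compact

variable {G : Type*} [Group G] [TopologicalSpace G] [SeparatelyContinuousMul G] [CompactSpace G]

/-- An open subgroup of a compact topological group has finite index (Mathlib's
`Subgroup.quotient_finite_of_isOpen`). -/
theorem finiteIndex_of_isOpen (H : Subgroup G) (h : IsOpen (H : Set G)) : H.FiniteIndex := by
  haveI := Subgroup.quotient_finite_of_isOpen H h
  exact Subgroup.finiteIndex_of_finite_quotient

end Compact

section CompactComm

variable {G : Type*} [CommGroup G] [TopologicalSpace G] [SeparatelyContinuousMul G]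
  [CompactSpace G]

/-- THE PARENTHETICAL OF §F.2: a character of finite order `n` of an OPEN subgroup `H` of a compact
commutative group extends only to characters of order dividing `[G : H] · n`. -/
theorem pow_eq_one_of_isOpen (H : Subgroup G) (h : IsOpen (H : Set G)) (φ : G →* M) (n : ℕ)
    (hn : ∀ h ∈ H, φ h ^ n = 1) (g : G) : φ g ^ (H.index * n) = 1 := by
  haveI := finiteIndex_of_isOpen H h
  exact pow_eq_one_of_finiteIndex H φ n hn g

/-- The same as a positive exponent. -/
theorem exists_pow_eq_one_of_isOpen (H : Subgroup G) (h : IsOpen (H : Set G)) (φ : G →* M)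
    (n : ℕ) (hn0 : 0 < n) (hn : ∀ h ∈ H, φ h ^ n = 1) : ∃ m : ℕ, 0 < m ∧ ∀ g : G, φ g ^ m = 1 := by
  haveI := finiteIndex_of_isOpen H h
  exact exists_pow_eq_one_of_finiteIndex H φ n hn0 hn

end CompactComm

end Summit.Ventures.HodgeRepro2.T5FiniteOrderExtension
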